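import Literature.MathematicalPhysics.QuantumFieldTheory.DimockYuan2024.QuadraticFlowSums

/-!
# Dimock–Yuan: the first linear equation of the flow (Lemma 18), scalar block — PROVED with
explicit constants

**Citation header (reproduction of PUBLISHED work; template file of the Balaban lattice Yang–Mills
cell `pub-balaban`, TEMPLATE.md §16.2; no manuscript under audit is touched).**
J. Dimock, C. Yuan, *Structural stability of the RG flow in the Gross–Neveu model*,
Ann. Henri Poincaré **25** (2024), doi 10.1007/s00023-024-01427-0 (= arXiv:2303.07916v3)
[DimockYuan2024GNFlow], §4.2 *"Reduction of the problem"* (p. 57; the weighted sequence spaces `X_w`, `X_r`,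
TeX ll. 3514–3526, p. 59) and §4.3 *"The first linear equation"* (l. 3531, p. 59), **Lemma 18** (TeX label `pixie`,
ll. 3545–3561, p. 59) with its proof (ll. 3565–3700, pp. 59–62); the null boundary conditions (bc0) are ll. 3495–3497 (p. 58).  TeX line numbers refer to the cell's held source
`inputs/files/dimock/src/2303.07916/2303.07916.tex`
(§ numbering: arXiv v3, whose section *"The flow"* is §4 — TeX l. 3274, `\label{five}` being a NAME —,
subsections §4.1–4.5; this file's earlier versions and TEMPLATE.md ≤ v8.31 wrote «§5.x»; corrected after XREAD
C-pv02g21-1 (D3); printed pages are those of the arXiv-v3 PDF.)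

**What the source prints.**  With `L_k = D_x Φ̄⁰_k(x̄_k)` = the matrix (amos2) (ll. 3588–3596, p. 60) acting on
`y_k = (E_k, g_k, z_k, p_k, v_k)`, Lemma 18: *"For `r_k ∈ X_r` there exists a unique solution `y_k = (E_k, g_k, z_k, p_k, v_k)` of
`y_{k+1} = L_k y_k + r_k` with null boundary conditions (bc0).  It satisfies for some constant `C`:
`‖y‖_{X_w} ≤ C‖r‖_{X_r}`"* — (bc0): *"`g_N = 0` and `E_0 = 0, z_0 = 0, p_0 = 0, v_0 = 0`"* —, where
`‖x‖_{X_w} = sup_k {ḡ_k^{−3}‖E_k‖, ḡ_k^{−2}|log ḡ_k|^{−1}|g_k|, ḡ_k^{−2}|log ḡ_k|^{−1}|z_k|, ḡ_k^{−2}|p_k|,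
ḡ_k^{−2}|v_k|}` and `‖x‖_{X_r} = sup_k {ḡ_k^{−3}‖E_k‖, ḡ_k^{−3}|g_k|, ḡ_k^{−3}|z_k|, ḡ_k^{−3}|p_k|, ḡ_k^{−3}|v_k|}`.
The proof: the `E`-row is `E_{k+1} = r^E_k` (trivial); *"Our strategy is to first solve (yumyum) for `p_k, v_k`
with zero initial condition.  Then solve for `g_k` with final condition … Then solve for `z_k` with zero
initial condition"* (ll. 3599–3600; sic «final condition `g_N = g_f`» there and at l. 3646 — the
lemma's (bc0) has `g_N = 0`, which is what is solved; see the located precisions below).  (i) `p_{k+1} = p_k − 2β′_kḡ_kv_k + r^p_k`,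
`v_{k+1} = v_k − β′_kḡ_kp_k + r^v_k`: *"The matrix of coefficients … has eigenvalues `1 ± √2β′_kḡ_k` and
a matrix of eigenvectors can be taken of the form `I + 𝒪(ḡ_k)`"* (ll. 3609–3610), then Lemma 19 with
`γ = √2` and (basicbound2) give (amos3) `|p̃_k| ≤ ḡ_k^γ Σ_{ℓ<k} ḡ_ℓ^{3−γ}‖r‖ ≤ Cḡ_k²‖r‖`;
(ii) `g_{k+1} = (1 + 2β_kḡ_k)g_k + r̃^g_k`, `r̃^g_k = −2β′_kḡ_kp_k − 4β′_kḡ_kv_k + r^g_k` (l. 3644, where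
the print has the slip *"−4β′_kḡ_kp_k"*), *"solved starting with `g_N = g_f` [sic] and counting down"* (l. 3646):
`g_{N−j} = −Σ_{ℓ=1}^{j} [Π_{i=ℓ}^{j} A_{N−i}] r̃^g_{N−ℓ}`, `A_k = (1 + 2β_kḡ_k)⁻¹`, with Lemma 19
`Π A ≤ 𝒪(1)(ḡ_{N−j}/ḡ_{N−ℓ+1})²` (l. 3656) and (basicbound2) first line ⇒ (tiktok2)
`|g_{N−j}| ≤ Cḡ²_{N−j}|log ḡ_{N−j}|‖r‖`; (iii) `z_{k+1} = z_k + 2θ_kḡ_kg_k + r̃^z_k`,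
`r̃^z_k = −θ^p_kḡ_kp_k − θ^v_kḡ_kv_k + r^z_k`, summed with (basicbound2) second line ⇒
`|z_k| ≤ Cḡ_k²|log ḡ_k|‖r‖` (ll. 3676–3700).  Inputs: Lemma 11 (`C₋ ≤ β_k ≤ C₊`, `|θ_k|, |θ^p_k|,
|θ^v_k| ≤ C`; l. 3318) and *"In the product we take `β′_i ≤ β_i`"* (l. 3623).

**What is PROVED here (theorem-only; Mathlib + the siblings `QuadraticFlow` / `QuadraticFlowSums`).**
The SCALAR block `(g, z, p, v)` of Lemma 18 — everything except the trivial `E`-row, which lives in a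
Banach space the template does not model — for ANY real sequences satisfying the printed recursions with
the null boundary conditions, the remainders bounded as in `X_r` (`|r^•_k| ≤ ḡ_k³·R`), along the
sibling's backward quadratic flow `ḡ = gbar β N g_f` (`0 < C₋ ≤ β_k ≤ C₊`, `0 ≤ β′_k ≤ β_k`,
`C₊g_f ≤ 1`), all bounds for `k ≤ N` and with EXPLICIT constants:
* Part 1 (`p`, `v`; ll. 3602–3636): `abs_uplus_le` / `abs_uminus_le` for the EXACT eigen-combinations
  `u_± = p ∓ √2·v` (which obey `u_±,{k+1} = (1 ± √2β′_kḡ_k)u_{±,k} + (r^p_k ∓ √2 r^v_k)`), and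
  **`abs_p_le` / `abs_v_le`**: `|p_k|, |v_k| ≤ K·ḡ_k²·R`, `K = (1+√2)/((2−√2)C₋)`.  DEVIATION (a
  genuinely shorter road, stated here as the house rule asks): instead of the print's Lemma 19 +
  (amos3) — available by name as `QuadraticFlowSums.DimockYuan2024_lemma19` / `amos3_sum` — the kernel
  runs the one-line induction `(1 + √2βḡ)Kḡ² + (1+√2)ḡ³ ≤ K(1 + 2βḡ)ḡ² ≤ Kḡ_{k+1}²`, which needs NO
  smallness beyond `C₊g_f ≤ 1` and loses no factor `3/2`.
* Part 2 (`g`; ll. 3638–3666), FOLLOWING THE PRINT: `g_eq_backward_sum` (the counting-down closed form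
  `g_k = −Σ_{ℓ∈[k,N)} (Π_{i∈[k,ℓ]} A_i)·r̃^g_ℓ`), then **`abs_g_le`**: `|g_k| ≤ G·ḡ_k²|log ḡ_k|·R`,
  `G = 4(6C₊K′ + 1)/C₋` for any a-priori `|p_k|, |v_k| ≤ K′ḡ_k²R`, via the sibling's inverted Lemma 19
  `prod_inv_le` at `γ = 2` (smallness `2C₊g_f ≤ log(3/2)`, `4C₊g_f ≤ log 2`) and (basicbound2) first
  line `basicbound2_one`.
* Part 3 (`z`; ll. 3676–3700), FOLLOWING THE PRINT: **`abs_z_le`**: `|z_k| ≤ Z·ḡ_k²|log ḡ_k|·R`,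
  `Z = (4/C₋)(2C_θG′ + 2C_θK′ + 1)`, via the sibling's `zsum_bound` ((basicbound2) at `n = 3, m = 1`;
  `g_f ≤ 1/4`).
* Part 4: existence and uniqueness of the solution of each recursion with its boundary condition
  (`exists_pv`, `pv_unique`, `exists_g`, `g_unique`, `exists_z`, `z_unique` — elementary), and the
  assembled **`DimockYuan2024_lemma18_scalar`** (the four `X_w`-weighted bounds at once).

**Located precision (Dimock-internal, records only; D10 is template, not under audit).**  The `p/v`
coefficient matrix `[[1, −2a],[−a, 1]]`, `a = β′_kḡ_k`, has the `k`-INDEPENDENT eigenvectors `(√2, ∓1)`,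
so the print's *"matrix of eigenvectors … of the form `I + 𝒪(ḡ_k)`"* can be taken CONSTANT (the change of
variables `u_± = p ∓ √2v` is exact at every `k`); l. 3644 prints `−4β′_kḡ_kp_k` for `−4β′_kḡ_kv_k`
(read off (amos2), l. 3588); ll. 3599 and 3646 say *"final condition `g_N = g_f`"* / *"starting with
`g_N = g_f`"* for the LINEAR equation, whose boundary condition (bc0) (l. 3496), used in the lemma's
statement and needed for the bound (bubbles) (at `r = 0` it forces `y = 0`), is `g_N = 0` — the kernel
solves with `g_N = 0`; (iv, added v1.2 after XREAD C-pv02g21-1 D1) l. 3606 prints the `v`-recursion as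
`v_{k+1} = v_k − β′_kḡ_k v_k + r^v_k`, a slip for `… − β′_kḡ_k p_k …` — (amos2) row 4 (l. 3593), the nonlinear
flow (l. 3286) and l. 3609's *"eigenvalues `1 ± √2β′_kḡ_k`"* all require `p_k` (with `v_k` the corner would be
`[[1, −2a],[0, 1 − a]]`, eigenvalues `1`, `1 − a`); the kernel's `hv` follows (amos2).  None of the four affects
anything.

**Why it is in the tree / scope.**  TEMPLATE.md §16.2 grades D10's Lemmas 18–22 / Theorem 4 «N» for the Bałaban audit
(B12 Theorem 2 asks only for the existence of SOME trajectory; `Step.couplingTrajectory_exists`); this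
leaf records, kernel-checked, the SHAPE of the linearised marginal flow's solution operator `S⁰`
(`‖S⁰‖_{𝓛(X_r,X_w)} ≤ C`) that a written proof of B12 Theorem 2 «in this style» would contain
(§16.2, row «Reduction of the problem»), with its constants.  With `QuadraticFlow` + `QuadraticFlowSums` the whole of D10
§4.1 and the scalar part of §4.3 Lemma 18 are kernel; for §4.4 (Lemmas 20–22) see the later sibling
`SecondLinearEquation`; Theorem 4 (§4.5: the contraction in `X_w`, the `t`-interpolation) is not formalised.  SCOPE: Dimock–Yuan's RG
is a momentum-slice decomposition on the continuum torus, not Bałaban's block averaging.  Nothing here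
refers to or asserts anything about Bałaban's papers.  Value = kernel reproduction of a printed lemma
of the template literature with explicit constants, NOT summit progress.

(v1.1, same unit/gen — DOCSTRING-ONLY own re-read before the XREAD verdict: three header quotations re-set verbatim
(`y_k = (E_k, g_k, z_k, p_k, v_k)`, «(yumyum)», «g_N = g_f [sic]»), one locator (l. 3632), one paraphrase
un-quoted; declarations byte-identical to v1 p190688.)
(v1.2, unit gen 25 — DOCSTRING-ONLY fold of XREAD C-pv02g21-1 (pv02-g21; verdict ok ∣ ABSOLUTE-RULE 0 ∣
kernel 0 ∣ DOCFIX 2 LOW): D1 = located precision (iv) above and the `uplus_succ`/`uminus_succ` notes; D2-residue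
(amos2) ll. 3588–3596; D3 section numerals §5.x ↦ arXiv-v3 §4.x lineage-wide; + printed page locators
(t4-lit2 NOTE); declarations byte-identical to v1/v1.1.)

Cell records: unit `b2b-balaban-template` gen 24; GAPS.md C-tmpl24-2.  NEW leaf; imports the sibling
`…DimockYuan2024.QuadraticFlowSums` only; sub-namespace `…DimockYuan2024.FirstLinearEquation`;
modifies nothing.
-/

noncomputable section

open Finset Real

namespace Literature.MathematicalPhysics.QuantumFieldTheory.DimockYuan2024.FirstLinearEquation

open Literature.MathematicalPhysics.QuantumFieldTheory.DimockYuan2024.QuadraticFlowSums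

variable {β βp : ℕ → ℝ} {N : ℕ} {gf : ℝ}

/-! ## Part 0. Two facts about the flow used repeatedly -/

/-- `ḡ_k²(1 + 2β_kḡ_k) ≤ ḡ_{k+1}²` (from `ḡ_{k+1} = ḡ_k(1 + β_kḡ_k)`). [folklore] -/
theorem gbar_sq_growth (hβ : ∀ k, 0 < β k) (hgf : 0 < gf) {k : ℕ} (hk : k < N) :
    gbar β N gf k ^ 2 * (1 + 2 * β k * gbar β N gf k) ≤ gbar β N gf (k + 1) ^ 2 := by
  rw [gbar_succ hβ hgf hk]
  have hx := gbar_pos hβ hgf (N := N) k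
  nlinarith [mul_pos (hβ k) hx, sq_nonneg (β k * gbar β N gf k ^ 2)]

/-- `β′_kḡ_k ≤ 1` when `0 ≤ β′ ≤ β ≤ C₊` and `C₊g_f ≤ 1`. [folklore] -/
theorem betap_gbar_le_one {Cm Cp : ℝ} (hCm : 0 < Cm) (hβ : ∀ k, Cm ≤ β k ∧ β k ≤ Cp)
    (hβp : ∀ k, 0 ≤ βp k ∧ βp k ≤ β k) (hgf : 0 < gf) (hsmall : Cp * gf ≤ 1) (k : ℕ) :
    βp k * gbar β N gf k ≤ 1 := by
  have hβpos : ∀ k, 0 < β k := fun k => lt_of_lt_of_le hCm (hβ k).1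
  have hCp : 0 ≤ Cp := le_trans hCm.le ((hβ 0).1.trans (hβ 0).2)
  have hx := gbar_pos hβpos hgf (N := N) k
  calc βp k * gbar β N gf k ≤ Cp * gf :=
        mul_le_mul ((hβp k).2.trans (hβ k).2) (gbar_le_final hβpos hgf (N := N) k) hx.le hCp
    _ ≤ 1 := hsmall

/-! ## Part 1. The `p`/`v` block (ll. 3602–3636) -/

/-- The EXACT eigen-combination `u₊ = p − √2 v` obeys `u₊,{k+1} = (1 + √2β′_kḡ_k)u₊,k + (r^p_k − √2r^v_k)`.
(The range ll. 3602–3619 contains the display l. 3606, which prints `v_{k+1} = v_k − β′_kḡ_k v_k + r^v_k` —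
`v_k` a slip for `p_k`; we follow (amos2) row 4, as the hypotheses `hp`/`hv` show.)
[cite: DimockYuan2024GNFlow, proof of Lemma 18 ("eigenvalues 1 ± √2β′_kḡ_k", arXiv:2303.07916v3 TeX ll. 3602–3619, p. 60)] -/
theorem uplus_succ {p v rp rv : ℕ → ℝ} {k : ℕ}
    (hp : p (k + 1) = p k - 2 * (βp k * gbar β N gf k) * v k + rp k)
    (hv : v (k + 1) = -(βp k * gbar β N gf k) * p k + v k + rv k) :
    p (k + 1) - Real.sqrt 2 * v (k + 1)
      = (1 + Real.sqrt 2 * (βp k * gbar β N gf k)) * (p k - Real.sqrt 2 * v k)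
        + (rp k - Real.sqrt 2 * rv k) := by
  have h2 : Real.sqrt 2 * Real.sqrt 2 = 2 := Real.mul_self_sqrt (by norm_num)
  rw [hp, hv]
  linear_combination (βp k * gbar β N gf k * v k) * h2

/-- The EXACT eigen-combination `u₋ = p + √2 v` obeys `u₋,{k+1} = (1 − √2β′_kḡ_k)u₋,k + (r^p_k + √2r^v_k)`.
(l. 3606 prints `v_k` for `p_k` in the `v`-recursion; we follow (amos2).)
[cite: DimockYuan2024GNFlow, proof of Lemma 18 (arXiv:2303.07916v3 TeX ll. 3602–3619, p. 60)] -/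
theorem uminus_succ {p v rp rv : ℕ → ℝ} {k : ℕ}
    (hp : p (k + 1) = p k - 2 * (βp k * gbar β N gf k) * v k + rp k)
    (hv : v (k + 1) = -(βp k * gbar β N gf k) * p k + v k + rv k) :
    p (k + 1) + Real.sqrt 2 * v (k + 1)
      = (1 - Real.sqrt 2 * (βp k * gbar β N gf k)) * (p k + Real.sqrt 2 * v k)
        + (rp k + Real.sqrt 2 * rv k) := by
  have h2 : Real.sqrt 2 * Real.sqrt 2 = 2 := Real.mul_self_sqrt (by norm_num)
  rw [hp, hv]
  linear_combination ((βp k * gbar β N gf k) * v k) * h2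

/-- The induction step behind both eigen-modes: with `K = (1+√2)/((2−√2)C₋)`,
`(1 + √2β_kḡ_k)·Kḡ_k²R + (1+√2)ḡ_k³R ≤ Kḡ_{k+1}²R`. [folklore] (the shorter road replacing the print's
Lemma 19 + (amos3)) -/
theorem mode_step {Cm Cp R : ℝ} (hCm : 0 < Cm) (hβ : ∀ k, Cm ≤ β k ∧ β k ≤ Cp)
    (hgf : 0 < gf) (hR : 0 ≤ R) {k : ℕ} (hk : k < N) :
    (1 + Real.sqrt 2 * (β k * gbar β N gf k)) *
        ((1 + Real.sqrt 2) / ((2 - Real.sqrt 2) * Cm) * gbar β N gf k ^ 2 * R)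
      + (1 + Real.sqrt 2) * gbar β N gf k ^ 3 * R
      ≤ (1 + Real.sqrt 2) / ((2 - Real.sqrt 2) * Cm) * gbar β N gf (k + 1) ^ 2 * R := by
  have hβpos : ∀ k, 0 < β k := fun k => lt_of_lt_of_le hCm (hβ k).1
  have hs2 : Real.sqrt 2 < 2 := by
    rw [show (2 : ℝ) = Real.sqrt 4 by
      rw [show (4 : ℝ) = 2 ^ 2 by norm_num, Real.sqrt_sq (by norm_num)]]
    exact Real.sqrt_lt_sqrt (by norm_num) (by norm_num)
  have hs0 : 0 ≤ Real.sqrt 2 := Real.sqrt_nonneg 2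
  set K := (1 + Real.sqrt 2) / ((2 - Real.sqrt 2) * Cm) with hKdef
  have hden : 0 < (2 - Real.sqrt 2) * Cm := mul_pos (by linarith) hCm
  have hK : 0 ≤ K := div_nonneg (by linarith) hden.le
  have hKid : K * ((2 - Real.sqrt 2) * Cm) = 1 + Real.sqrt 2 := div_mul_cancel₀ _ hden.ne'
  set x := gbar β N gf k with hxdef
  have hx : 0 < x := gbar_pos hβpos hgf (N := N) k
  have hgrow := gbar_sq_growth hβpos hgf hk
  rw [← hxdef] at hgrow
  -- (1+√2) x ≤ (2-√2) K β_k x, since (2-√2) K Cm = 1+√2 and β_k ≥ Cm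
  have hkey : (1 + Real.sqrt 2) * x ^ 3 ≤ (2 - Real.sqrt 2) * K * β k * x ^ 3 := by
    have h1 : (1 + Real.sqrt 2) ≤ (2 - Real.sqrt 2) * K * β k := by
      calc (1 + Real.sqrt 2) = K * ((2 - Real.sqrt 2) * Cm) := hKid.symm
        _ = (2 - Real.sqrt 2) * K * Cm := by ring
        _ ≤ (2 - Real.sqrt 2) * K * β k :=
            mul_le_mul_of_nonneg_left (hβ k).1 (mul_nonneg (by linarith) hK)
    exact mul_le_mul_of_nonneg_right h1 (pow_nonneg hx.le 3)
  -- assemble: LHS ≤ K x²(1+2βx) R ≤ K ḡ_{k+1}² R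
  have hmid : (1 + Real.sqrt 2 * (β k * x)) * (K * x ^ 2 * R) + (1 + Real.sqrt 2) * x ^ 3 * R
      ≤ K * (x ^ 2 * (1 + 2 * β k * x)) * R := by
    have := mul_le_mul_of_nonneg_right hkey hR
    nlinarith [this]
  calc (1 + Real.sqrt 2 * (β k * x)) * (K * x ^ 2 * R) + (1 + Real.sqrt 2) * x ^ 3 * R
      ≤ K * (x ^ 2 * (1 + 2 * β k * x)) * R := hmid
    _ ≤ K * gbar β N gf (k + 1) ^ 2 * R := by
        have := mul_le_mul_of_nonneg_left hgrow hK
        exact mul_le_mul_of_nonneg_right this hR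

/-- **Growing mode**: `|p_k − √2v_k| ≤ K·ḡ_k²·R` for `k ≤ N`, `K = (1+√2)/((2−√2)C₋)`.
[cite: DimockYuan2024GNFlow, proof of Lemma 18, eq. (amos3) (arXiv:2303.07916v3 TeX ll. 3620–3631)] -/
theorem abs_uplus_le {Cm Cp R : ℝ} {p v rp rv : ℕ → ℝ} (hCm : 0 < Cm)
    (hβ : ∀ k, Cm ≤ β k ∧ β k ≤ Cp) (hβp : ∀ k, 0 ≤ βp k ∧ βp k ≤ β k) (hgf : 0 < gf)
    (hR : 0 ≤ R) (hp0 : p 0 = 0) (hv0 : v 0 = 0)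
    (hp : ∀ k, k < N → p (k + 1) = p k - 2 * (βp k * gbar β N gf k) * v k + rp k)
    (hv : ∀ k, k < N → v (k + 1) = -(βp k * gbar β N gf k) * p k + v k + rv k)
    (hrp : ∀ k, |rp k| ≤ gbar β N gf k ^ 3 * R) (hrv : ∀ k, |rv k| ≤ gbar β N gf k ^ 3 * R)
    {k : ℕ} (hk : k ≤ N) :
    |p k - Real.sqrt 2 * v k| ≤
      (1 + Real.sqrt 2) / ((2 - Real.sqrt 2) * Cm) * gbar β N gf k ^ 2 * R := by
  have hβpos : ∀ k, 0 < β k := fun k => lt_of_lt_of_le hCm (hβ k).1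
  have hs0 : 0 ≤ Real.sqrt 2 := Real.sqrt_nonneg 2
  have hs1 : |Real.sqrt 2| = Real.sqrt 2 := abs_of_nonneg hs0
  induction k with
  | zero =>
    rw [hp0, hv0]; simp only [mul_zero, sub_zero, abs_zero]
    have hden : 0 < (2 - Real.sqrt 2) * Cm := by
      have hs2 : Real.sqrt 2 < 2 := by
        rw [show (2 : ℝ) = Real.sqrt 4 by
          rw [show (4 : ℝ) = 2 ^ 2 by norm_num, Real.sqrt_sq (by norm_num)]]
        exact Real.sqrt_lt_sqrt (by norm_num) (by norm_num)
      exact mul_pos (by linarith) hCm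
    exact mul_nonneg (mul_nonneg (div_nonneg (by linarith) hden.le) (sq_nonneg _)) hR
  | succ k ih =>
    have hkN : k < N := Nat.lt_of_succ_le hk
    have ih' := ih hkN.le
    rw [uplus_succ (hp k hkN) (hv k hkN)]
    have ha0 : 0 ≤ βp k * gbar β N gf k :=
      mul_nonneg (hβp k).1 (gbar_pos hβpos hgf (N := N) k).le
    have hm0 : 0 ≤ 1 + Real.sqrt 2 * (βp k * gbar β N gf k) := by positivity
    have hs : |rp k - Real.sqrt 2 * rv k| ≤ (1 + Real.sqrt 2) * gbar β N gf k ^ 3 * R := by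
      calc |rp k - Real.sqrt 2 * rv k| ≤ |rp k| + |Real.sqrt 2 * rv k| := abs_sub _ _
        _ = |rp k| + Real.sqrt 2 * |rv k| := by rw [abs_mul, hs1]
        _ ≤ gbar β N gf k ^ 3 * R + Real.sqrt 2 * (gbar β N gf k ^ 3 * R) :=
            add_le_add (hrp k) (mul_le_mul_of_nonneg_left (hrv k) hs0)
        _ = (1 + Real.sqrt 2) * gbar β N gf k ^ 3 * R := by ring
    have hmode := mode_step (β := β) (N := N) hCm hβ hgf hR hkN
    -- the multiplier with β′ is at most the one with β
    have hmul : (1 + Real.sqrt 2 * (βp k * gbar β N gf k)) *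
          ((1 + Real.sqrt 2) / ((2 - Real.sqrt 2) * Cm) * gbar β N gf k ^ 2 * R)
        ≤ (1 + Real.sqrt 2 * (β k * gbar β N gf k)) *
          ((1 + Real.sqrt 2) / ((2 - Real.sqrt 2) * Cm) * gbar β N gf k ^ 2 * R) := by
      apply mul_le_mul_of_nonneg_right _ (le_trans (abs_nonneg _) ih')
      have := mul_le_mul_of_nonneg_right (hβp k).2 (gbar_pos hβpos hgf (N := N) k).le
      nlinarith [hs0]
    calc |(1 + Real.sqrt 2 * (βp k * gbar β N gf k)) * (p k - Real.sqrt 2 * v k)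
            + (rp k - Real.sqrt 2 * rv k)|
        ≤ |(1 + Real.sqrt 2 * (βp k * gbar β N gf k)) * (p k - Real.sqrt 2 * v k)|
            + |rp k - Real.sqrt 2 * rv k| := abs_add_le _ _
      _ = (1 + Real.sqrt 2 * (βp k * gbar β N gf k)) * |p k - Real.sqrt 2 * v k|
            + |rp k - Real.sqrt 2 * rv k| := by rw [abs_mul, abs_of_nonneg hm0]
      _ ≤ (1 + Real.sqrt 2 * (βp k * gbar β N gf k)) *
            ((1 + Real.sqrt 2) / ((2 - Real.sqrt 2) * Cm) * gbar β N gf k ^ 2 * R)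
            + (1 + Real.sqrt 2) * gbar β N gf k ^ 3 * R :=
          add_le_add (mul_le_mul_of_nonneg_left ih' hm0) hs
      _ ≤ _ := le_trans (add_le_add hmul le_rfl) hmode

/-- **Contracting mode**: `|p_k + √2v_k| ≤ K·ḡ_k²·R` for `k ≤ N` (*"The ṽ_k trivially satisfies the same
bound"*, l. 3632), using `|1 − √2β′_kḡ_k| ≤ 1` from `β′_kḡ_k ≤ C₊g_f ≤ 1`.
[cite: DimockYuan2024GNFlow, proof of Lemma 18 (arXiv:2303.07916v3 TeX ll. 3620–3636)] -/
theorem abs_uminus_le {Cm Cp R : ℝ} {p v rp rv : ℕ → ℝ} (hCm : 0 < Cm)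
    (hβ : ∀ k, Cm ≤ β k ∧ β k ≤ Cp) (hβp : ∀ k, 0 ≤ βp k ∧ βp k ≤ β k) (hgf : 0 < gf)
    (hsmall : Cp * gf ≤ 1) (hR : 0 ≤ R) (hp0 : p 0 = 0) (hv0 : v 0 = 0)
    (hp : ∀ k, k < N → p (k + 1) = p k - 2 * (βp k * gbar β N gf k) * v k + rp k)
    (hv : ∀ k, k < N → v (k + 1) = -(βp k * gbar β N gf k) * p k + v k + rv k)
    (hrp : ∀ k, |rp k| ≤ gbar β N gf k ^ 3 * R) (hrv : ∀ k, |rv k| ≤ gbar β N gf k ^ 3 * R)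
    {k : ℕ} (hk : k ≤ N) :
    |p k + Real.sqrt 2 * v k| ≤
      (1 + Real.sqrt 2) / ((2 - Real.sqrt 2) * Cm) * gbar β N gf k ^ 2 * R := by
  have hβpos : ∀ k, 0 < β k := fun k => lt_of_lt_of_le hCm (hβ k).1
  have hs0 : 0 ≤ Real.sqrt 2 := Real.sqrt_nonneg 2
  have hs1 : |Real.sqrt 2| = Real.sqrt 2 := abs_of_nonneg hs0
  have hs2 : Real.sqrt 2 < 2 := by
    rw [show (2 : ℝ) = Real.sqrt 4 by
      rw [show (4 : ℝ) = 2 ^ 2 by norm_num, Real.sqrt_sq (by norm_num)]]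
    exact Real.sqrt_lt_sqrt (by norm_num) (by norm_num)
  have hden : 0 < (2 - Real.sqrt 2) * Cm := mul_pos (by linarith) hCm
  have hK : 0 ≤ (1 + Real.sqrt 2) / ((2 - Real.sqrt 2) * Cm) := div_nonneg (by linarith) hden.le
  induction k with
  | zero =>
    rw [hp0, hv0]; simp only [mul_zero, add_zero, abs_zero]
    exact mul_nonneg (mul_nonneg hK (sq_nonneg _)) hR
  | succ k ih =>
    have hkN : k < N := Nat.lt_of_succ_le hk
    have ih' := ih hkN.le
    rw [uminus_succ (hp k hkN) (hv k hkN)]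
    have ha0 : 0 ≤ βp k * gbar β N gf k :=
      mul_nonneg (hβp k).1 (gbar_pos hβpos hgf (N := N) k).le
    have ha1 : βp k * gbar β N gf k ≤ 1 := betap_gbar_le_one hCm hβ hβp hgf hsmall k
    have hm1 : |1 - Real.sqrt 2 * (βp k * gbar β N gf k)| ≤ 1 := by
      rw [abs_le]; constructor <;> nlinarith
    have hs : |rp k + Real.sqrt 2 * rv k| ≤ (1 + Real.sqrt 2) * gbar β N gf k ^ 3 * R := by
      calc |rp k + Real.sqrt 2 * rv k| ≤ |rp k| + |Real.sqrt 2 * rv k| := abs_add_le _ _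
        _ = |rp k| + Real.sqrt 2 * |rv k| := by rw [abs_mul, hs1]
        _ ≤ gbar β N gf k ^ 3 * R + Real.sqrt 2 * (gbar β N gf k ^ 3 * R) :=
            add_le_add (hrp k) (mul_le_mul_of_nonneg_left (hrv k) hs0)
        _ = (1 + Real.sqrt 2) * gbar β N gf k ^ 3 * R := by ring
    have hmode := mode_step (β := β) (N := N) hCm hβ hgf hR hkN
    have hX : 0 ≤ (1 + Real.sqrt 2) / ((2 - Real.sqrt 2) * Cm) * gbar β N gf k ^ 2 * R :=
      le_trans (abs_nonneg _) ih'
    have hβx : 0 ≤ Real.sqrt 2 * (β k * gbar β N gf k) :=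
      mul_nonneg hs0 (mul_nonneg (hβpos k).le (gbar_pos hβpos hgf (N := N) k).le)
    calc |(1 - Real.sqrt 2 * (βp k * gbar β N gf k)) * (p k + Real.sqrt 2 * v k)
            + (rp k + Real.sqrt 2 * rv k)|
        ≤ |(1 - Real.sqrt 2 * (βp k * gbar β N gf k)) * (p k + Real.sqrt 2 * v k)|
            + |rp k + Real.sqrt 2 * rv k| := abs_add_le _ _
      _ = |1 - Real.sqrt 2 * (βp k * gbar β N gf k)| * |p k + Real.sqrt 2 * v k|
            + |rp k + Real.sqrt 2 * rv k| := by rw [abs_mul]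
      _ ≤ 1 * ((1 + Real.sqrt 2) / ((2 - Real.sqrt 2) * Cm) * gbar β N gf k ^ 2 * R)
            + (1 + Real.sqrt 2) * gbar β N gf k ^ 3 * R :=
          add_le_add (mul_le_mul hm1 ih' (abs_nonneg _) zero_le_one) hs
      _ ≤ (1 + Real.sqrt 2 * (β k * gbar β N gf k)) *
            ((1 + Real.sqrt 2) / ((2 - Real.sqrt 2) * Cm) * gbar β N gf k ^ 2 * R)
            + (1 + Real.sqrt 2) * gbar β N gf k ^ 3 * R := by
          nlinarith [mul_nonneg hβx hX]
      _ ≤ _ := hmode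

/-- **`|p_k| ≤ K·ḡ_k²·R`** for `k ≤ N`, `K = (1+√2)/((2−√2)C₋)` (print: *"`|p̃_k| ≤ … ≤ Cḡ_k²‖r‖_{X_r}` …
hence so do `p_k, v_k`"*).
[cite: DimockYuan2024GNFlow, proof of Lemma 18, (amos3) and the sentence after it (arXiv:2303.07916v3 TeX ll. 3628–3636)] -/
theorem abs_p_le {Cm Cp R : ℝ} {p v rp rv : ℕ → ℝ} (hCm : 0 < Cm)
    (hβ : ∀ k, Cm ≤ β k ∧ β k ≤ Cp) (hβp : ∀ k, 0 ≤ βp k ∧ βp k ≤ β k) (hgf : 0 < gf)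
    (hsmall : Cp * gf ≤ 1) (hR : 0 ≤ R) (hp0 : p 0 = 0) (hv0 : v 0 = 0)
    (hp : ∀ k, k < N → p (k + 1) = p k - 2 * (βp k * gbar β N gf k) * v k + rp k)
    (hv : ∀ k, k < N → v (k + 1) = -(βp k * gbar β N gf k) * p k + v k + rv k)
    (hrp : ∀ k, |rp k| ≤ gbar β N gf k ^ 3 * R) (hrv : ∀ k, |rv k| ≤ gbar β N gf k ^ 3 * R)
    {k : ℕ} (hk : k ≤ N) :
    |p k| ≤ (1 + Real.sqrt 2) / ((2 - Real.sqrt 2) * Cm) * gbar β N gf k ^ 2 * R := by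
  have h1 := abs_uplus_le hCm hβ hβp hgf hR hp0 hv0 hp hv hrp hrv hk
  have h2 := abs_uminus_le hCm hβ hβp hgf hsmall hR hp0 hv0 hp hv hrp hrv hk
  have e : p k = ((p k - Real.sqrt 2 * v k) + (p k + Real.sqrt 2 * v k)) / 2 := by ring
  rw [e, abs_div, abs_two]
  have := abs_add_le (p k - Real.sqrt 2 * v k) (p k + Real.sqrt 2 * v k)
  linarith

/-- **`|v_k| ≤ K·ḡ_k²·R`** for `k ≤ N` (indeed `≤ K·ḡ_k²·R/√2`).
[cite: DimockYuan2024GNFlow, proof of Lemma 18 (arXiv:2303.07916v3 TeX ll. 3628–3636)] -/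
theorem abs_v_le {Cm Cp R : ℝ} {p v rp rv : ℕ → ℝ} (hCm : 0 < Cm)
    (hβ : ∀ k, Cm ≤ β k ∧ β k ≤ Cp) (hβp : ∀ k, 0 ≤ βp k ∧ βp k ≤ β k) (hgf : 0 < gf)
    (hsmall : Cp * gf ≤ 1) (hR : 0 ≤ R) (hp0 : p 0 = 0) (hv0 : v 0 = 0)
    (hp : ∀ k, k < N → p (k + 1) = p k - 2 * (βp k * gbar β N gf k) * v k + rp k)
    (hv : ∀ k, k < N → v (k + 1) = -(βp k * gbar β N gf k) * p k + v k + rv k)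
    (hrp : ∀ k, |rp k| ≤ gbar β N gf k ^ 3 * R) (hrv : ∀ k, |rv k| ≤ gbar β N gf k ^ 3 * R)
    {k : ℕ} (hk : k ≤ N) :
    |v k| ≤ (1 + Real.sqrt 2) / ((2 - Real.sqrt 2) * Cm) * gbar β N gf k ^ 2 * R := by
  have h1 := abs_uplus_le hCm hβ hβp hgf hR hp0 hv0 hp hv hrp hrv hk
  have h2 := abs_uminus_le hCm hβ hβp hgf hsmall hR hp0 hv0 hp hv hrp hrv hk
  set X := (1 + Real.sqrt 2) / ((2 - Real.sqrt 2) * Cm) * gbar β N gf k ^ 2 * R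
  have hX : 0 ≤ X := le_trans (abs_nonneg _) h1
  have hs : 1 < Real.sqrt 2 := by
    rw [show (1 : ℝ) = Real.sqrt 1 from Real.sqrt_one.symm]
    exact Real.sqrt_lt_sqrt (by norm_num) (by norm_num)
  have e : v k = ((p k + Real.sqrt 2 * v k) - (p k - Real.sqrt 2 * v k)) / (2 * Real.sqrt 2) := by
    field_simp
    ring
  have hden : 0 < 2 * Real.sqrt 2 := by positivity
  rw [e, abs_div, abs_of_pos hden, div_le_iff₀ hden]
  have := abs_sub (p k + Real.sqrt 2 * v k) (p k - Real.sqrt 2 * v k)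
  nlinarith

/-! ## Part 2. The `g` equation, counting down (ll. 3638–3666) -/

/-- The counting-down CLOSED FORM: if `g_N = 0` and `g_{k+1} = (1 + 2β_kḡ_k)g_k + t_k` (`k < N`), then for
`k ≤ N`, `g_k = −Σ_{ℓ∈[k,N)} (Π_{i∈[k,ℓ]} A_i)·t_ℓ`, `A_i = (1 + 2β_iḡ_i)⁻¹` (print: *"`g_{N−j} =
A_{N−j}(g_{N−j+1} − r^g_{N−j})` … The solution is `g_{N−j} = −Σ_{ℓ=1}^{j}[Π_{i=ℓ}^{j}A_{N−i}] r̃^g_{N−ℓ}`"*).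
[cite: DimockYuan2024GNFlow, proof of Lemma 18 (arXiv:2303.07916v3 TeX ll. 3645–3652)] -/
theorem g_eq_backward_sum (hβ : ∀ k, 0 < β k) (hgf : 0 < gf) {g t : ℕ → ℝ} (hgN : g N = 0)
    (hg : ∀ k, k < N → g (k + 1) = (1 + 2 * β k * gbar β N gf k) * g k + t k)
    {k : ℕ} (hk : k ≤ N) :
    g k = -∑ ℓ ∈ Ico k N, (∏ i ∈ Ico k (ℓ + 1), (1 + 2 * β i * gbar β N gf i)⁻¹) * t ℓ := by
  -- induction on the number m = N - k of backward steps
  suffices H : ∀ m, m ≤ N →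
      g (N - m) = -∑ ℓ ∈ Ico (N - m) N,
        (∏ i ∈ Ico (N - m) (ℓ + 1), (1 + 2 * β i * gbar β N gf i)⁻¹) * t ℓ by
    have := H (N - k) (Nat.sub_le N k)
    rwa [show N - (N - k) = k by omega] at this
  intro m
  induction m with
  | zero => intro _; simp [hgN]
  | succ m ih =>
    intro hm
    have hm' : m ≤ N := Nat.le_of_succ_le hm
    set k' := N - (m + 1) with hk'
    have hk'N : k' < N := by omega
    have hsk : k' + 1 = N - m := by omega
    have ih' := ih hm'
    rw [← hsk] at ih'
    -- g k' from g (k'+1)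
    have hA : 0 < 1 + 2 * β k' * gbar β N gf k' := by
      have := mul_pos (hβ k') (gbar_pos hβ hgf (N := N) k'); linarith
    set A := (1 + 2 * β k' * gbar β N gf k')⁻¹ with hAdef
    have hgk : g k' = A * (g (k' + 1) - t k') := by
      rw [hg k' hk'N, hAdef]; field_simp; ring
    -- first term: ℓ = k'
    have e1 : ∏ i ∈ Ico k' (k' + 1), (1 + 2 * β i * gbar β N gf i)⁻¹ = A := by
      rw [Nat.Ico_succ_singleton, Finset.prod_singleton]
    -- remaining terms: pull A_{k'} into each product
    have e2 : ∀ ℓ ∈ Ico (k' + 1) N,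
        A * ((∏ i ∈ Ico (k' + 1) (ℓ + 1), (1 + 2 * β i * gbar β N gf i)⁻¹) * t ℓ)
          = (∏ i ∈ Ico k' (ℓ + 1), (1 + 2 * β i * gbar β N gf i)⁻¹) * t ℓ := by
      intro ℓ hℓ
      have hℓ' : k' < ℓ + 1 := by
        have := (Finset.mem_Ico.mp hℓ).1; omega
      rw [Finset.prod_eq_prod_Ico_succ_bot hℓ', hAdef]
      ring
    calc g k' = A * (g (k' + 1) - t k') := hgk
      _ = -(A * t k') - A * ∑ ℓ ∈ Ico (k' + 1) N,
            (∏ i ∈ Ico (k' + 1) (ℓ + 1), (1 + 2 * β i * gbar β N gf i)⁻¹) * t ℓ := by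
          rw [ih']; ring
      _ = -(A * t k') - ∑ ℓ ∈ Ico (k' + 1) N,
            (∏ i ∈ Ico k' (ℓ + 1), (1 + 2 * β i * gbar β N gf i)⁻¹) * t ℓ := by
          rw [Finset.mul_sum, Finset.sum_congr rfl e2]
      _ = -∑ ℓ ∈ Ico k' N, (∏ i ∈ Ico k' (ℓ + 1), (1 + 2 * β i * gbar β N gf i)⁻¹) * t ℓ := by
          rw [Finset.sum_eq_sum_Ico_succ_bot hk'N, e1]; ring

/-- **`|g_k| ≤ G·ḡ_k²|log ḡ_k|·R`** for `k ≤ N`, `G = 4(6C₊K′ + 1)/C₋`, for any solution of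
`g_{k+1} = (1 + 2β_kḡ_k)g_k − 2β′_kḡ_kp_k − 4β′_kḡ_kv_k + r^g_k`, `g_N = 0`, given a-priori bounds
`|p_k|, |v_k| ≤ K′ḡ_k²R`, `|r^g_k| ≤ ḡ_k³R` — FOLLOWING THE PRINT: the closed form, the sibling's inverted
Lemma 19 `Π_{i∈[k,ℓ]}A_i ≤ 2(ḡ_k/ḡ_{ℓ+1})²` (at `γ = 2`; smallness `2C₊g_f ≤ log(3/2)`, `4C₊g_f ≤ log 2`),
`ḡ_ℓ³/ḡ_{ℓ+1}² ≤ ḡ_ℓ`, and (basicbound2) first line `Σ_{ℓ∈[k,N)} ḡ_ℓ ≤ (2/C₋)|log ḡ_k|` — eq. (tiktok2)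
*"`|g_{N−j}| ≤ Cḡ²_{N−j}Σ_{ℓ=1}^{j}ḡ_{N−ℓ}‖r‖_{X_r} ≤ Cḡ²_{N−j}|log ḡ_{N−j}|‖r‖_{X_r}`"*.
[cite: DimockYuan2024GNFlow, proof of Lemma 18, eqs. (tiktok2)/(tiktok3) (arXiv:2303.07916v3 TeX ll. 3638–3666)] -/
theorem abs_g_le {Cm Cp R K' : ℝ} {g p v rg : ℕ → ℝ} (hCm : 0 < Cm)
    (hβ : ∀ k, Cm ≤ β k ∧ β k ≤ Cp) (hβp : ∀ k, 0 ≤ βp k ∧ βp k ≤ β k) (hgf : 0 < gf)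
    (hgf4 : gf ≤ 1 / 4) (hsmall : Cp * gf ≤ 1)
    (hγ1 : 2 * (Cp * gf) ≤ Real.log (3 / 2)) (hγ2 : 4 * (Cp * gf) ≤ Real.log 2)
    (hR : 0 ≤ R) (hK' : 0 ≤ K')
    (hpb : ∀ k, k ≤ N → |p k| ≤ K' * gbar β N gf k ^ 2 * R)
    (hvb : ∀ k, k ≤ N → |v k| ≤ K' * gbar β N gf k ^ 2 * R)
    (hrg : ∀ k, |rg k| ≤ gbar β N gf k ^ 3 * R) (hgN : g N = 0)
    (hg : ∀ k, k < N → g (k + 1) = (1 + 2 * β k * gbar β N gf k) * g k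
        - 2 * (βp k * gbar β N gf k) * p k - 4 * (βp k * gbar β N gf k) * v k + rg k)
    {k : ℕ} (hk : k ≤ N) :
    |g k| ≤ 4 * (6 * Cp * K' + 1) / Cm * (gbar β N gf k ^ 2 * |Real.log (gbar β N gf k)|) * R := by
  have hβpos : ∀ k, 0 < β k := fun k => lt_of_lt_of_le hCm (hβ k).1
  have hCp : 0 ≤ Cp := le_trans hCm.le ((hβ 0).1.trans (hβ 0).2)
  -- the remainder t
  set t : ℕ → ℝ := fun k =>
    -(2 * (βp k * gbar β N gf k) * p k) - 4 * (βp k * gbar β N gf k) * v k + rg k with htdef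
  have hg' : ∀ k, k < N → g (k + 1) = (1 + 2 * β k * gbar β N gf k) * g k + t k := by
    intro k hk; rw [hg k hk, htdef]; ring
  set Ct := 6 * Cp * K' + 1 with hCtdef
  have hCt : 0 ≤ Ct := by rw [hCtdef]; positivity
  have ht : ∀ ℓ, ℓ < N → |t ℓ| ≤ Ct * gbar β N gf ℓ ^ 3 * R := by
    intro ℓ hℓ
    have hx := gbar_pos hβpos hgf (N := N) ℓ
    have ha0 : 0 ≤ βp ℓ * gbar β N gf ℓ := mul_nonneg (hβp ℓ).1 hx.le
    have haC : βp ℓ * gbar β N gf ℓ ≤ Cp * gbar β N gf ℓ :=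
      mul_le_mul_of_nonneg_right ((hβp ℓ).2.trans (hβ ℓ).2) hx.le
    have h1 : |-(2 * (βp ℓ * gbar β N gf ℓ) * p ℓ)| ≤ 2 * (Cp * gbar β N gf ℓ) * (K' * gbar β N gf ℓ ^ 2 * R) := by
      rw [abs_neg, abs_mul, abs_of_nonneg (by positivity : (0:ℝ) ≤ 2 * (βp ℓ * gbar β N gf ℓ))]
      exact mul_le_mul (by linarith) (hpb ℓ hℓ.le) (abs_nonneg _) (by positivity)
    have h2 : |4 * (βp ℓ * gbar β N gf ℓ) * v ℓ| ≤ 4 * (Cp * gbar β N gf ℓ) * (K' * gbar β N gf ℓ ^ 2 * R) := by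
      rw [abs_mul, abs_of_nonneg (by positivity : (0:ℝ) ≤ 4 * (βp ℓ * gbar β N gf ℓ))]
      exact mul_le_mul (by linarith) (hvb ℓ hℓ.le) (abs_nonneg _) (by positivity)
    calc |t ℓ| = |-(2 * (βp ℓ * gbar β N gf ℓ) * p ℓ) - 4 * (βp ℓ * gbar β N gf ℓ) * v ℓ + rg ℓ| := rfl
      _ ≤ |-(2 * (βp ℓ * gbar β N gf ℓ) * p ℓ) - 4 * (βp ℓ * gbar β N gf ℓ) * v ℓ| + |rg ℓ| :=
          abs_add_le _ _
      _ ≤ (|-(2 * (βp ℓ * gbar β N gf ℓ) * p ℓ)| + |4 * (βp ℓ * gbar β N gf ℓ) * v ℓ|) + |rg ℓ| :=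
          add_le_add (abs_sub _ _) le_rfl
      _ ≤ (2 * (Cp * gbar β N gf ℓ) * (K' * gbar β N gf ℓ ^ 2 * R)
            + 4 * (Cp * gbar β N gf ℓ) * (K' * gbar β N gf ℓ ^ 2 * R)) + gbar β N gf ℓ ^ 3 * R :=
          add_le_add (add_le_add h1 h2) (hrg ℓ)
      _ = Ct * gbar β N gf ℓ ^ 3 * R := by rw [hCtdef]; ring
  -- closed form and termwise bound
  rw [g_eq_backward_sum hβpos hgf hgN hg' hk, abs_neg]
  have hxk := gbar_pos hβpos hgf (N := N) k
  have hterm : ∀ ℓ ∈ Ico k N,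
      |(∏ i ∈ Ico k (ℓ + 1), (1 + 2 * β i * gbar β N gf i)⁻¹) * t ℓ|
        ≤ 2 * Ct * R * gbar β N gf k ^ 2 * gbar β N gf ℓ := by
    intro ℓ hℓ
    have hℓ' := Finset.mem_Ico.mp hℓ
    have hP0 : 0 ≤ ∏ i ∈ Ico k (ℓ + 1), (1 + 2 * β i * gbar β N gf i)⁻¹ :=
      Finset.prod_nonneg fun i _ => by
        have := mul_pos (hβpos i) (gbar_pos hβpos hgf (N := N) i)
        exact inv_nonneg.mpr (by linarith)
    -- inverted Lemma 19 at γ = 2 (rpow exponent 2 ↦ the square)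
    have hinv' : ∏ i ∈ Ico k (ℓ + 1), (1 + 2 * β i * gbar β N gf i)⁻¹
        ≤ 2 * (gbar β N gf k / gbar β N gf (ℓ + 1)) ^ 2 := by
      rw [← Real.rpow_two]
      have hle : k ≤ ℓ + 1 := by omega
      have hγ2' : (2:ℝ) ^ 2 * (Cp * gf) ≤ Real.log 2 := by nlinarith
      exact prod_inv_le (β := β) (N := N) (γ := 2) hCm hβ hgf (by norm_num) hγ1 hγ2' hle hℓ'.2
    have hxl := gbar_pos hβpos hgf (N := N) ℓ
    have hxl1 := gbar_pos hβpos hgf (N := N) (ℓ + 1)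
    have hmono : gbar β N gf ℓ ≤ gbar β N gf (ℓ + 1) :=
      (gbar_lt_succ hβpos hgf hℓ'.2).le
    -- (ḡ_k/ḡ_{ℓ+1})² ḡ_ℓ³ ≤ ḡ_k² ḡ_ℓ
    have hgeom : (gbar β N gf k / gbar β N gf (ℓ + 1)) ^ 2 * gbar β N gf ℓ ^ 3
        ≤ gbar β N gf k ^ 2 * gbar β N gf ℓ := by
      rw [div_pow, div_mul_eq_mul_div, div_le_iff₀ (pow_pos hxl1 2)]
      have h3 : gbar β N gf ℓ ^ 3 ≤ gbar β N gf ℓ * gbar β N gf (ℓ + 1) ^ 2 := by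
        have := mul_le_mul hmono hmono hxl.le hxl1.le
        nlinarith [this, hxl]
      calc gbar β N gf k ^ 2 * gbar β N gf ℓ ^ 3 ≤ gbar β N gf k ^ 2 * (gbar β N gf ℓ * gbar β N gf (ℓ + 1) ^ 2) :=
            mul_le_mul_of_nonneg_left h3 (sq_nonneg _)
        _ = gbar β N gf k ^ 2 * gbar β N gf ℓ * gbar β N gf (ℓ + 1) ^ 2 := by ring
    rw [abs_mul, abs_of_nonneg hP0]
    calc (∏ i ∈ Ico k (ℓ + 1), (1 + 2 * β i * gbar β N gf i)⁻¹) * |t ℓ|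
        ≤ (2 * (gbar β N gf k / gbar β N gf (ℓ + 1)) ^ 2) * (Ct * gbar β N gf ℓ ^ 3 * R) :=
          mul_le_mul hinv' (ht ℓ hℓ'.2) (abs_nonneg _) (by positivity)
      _ = 2 * Ct * R * ((gbar β N gf k / gbar β N gf (ℓ + 1)) ^ 2 * gbar β N gf ℓ ^ 3) := by ring
      _ ≤ 2 * Ct * R * (gbar β N gf k ^ 2 * gbar β N gf ℓ) :=
          mul_le_mul_of_nonneg_left hgeom (by positivity)
      _ = 2 * Ct * R * gbar β N gf k ^ 2 * gbar β N gf ℓ := by ring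
  -- sum and (basicbound2) first line
  have hsum := basicbound2_one (β := β) (N := N) hCm hβ hgf (by linarith) hsmall hk le_rfl
  calc |∑ ℓ ∈ Ico k N, (∏ i ∈ Ico k (ℓ + 1), (1 + 2 * β i * gbar β N gf i)⁻¹) * t ℓ|
      ≤ ∑ ℓ ∈ Ico k N, |(∏ i ∈ Ico k (ℓ + 1), (1 + 2 * β i * gbar β N gf i)⁻¹) * t ℓ| :=
        Finset.abs_sum_le_sum_abs _ _
    _ ≤ ∑ ℓ ∈ Ico k N, 2 * Ct * R * gbar β N gf k ^ 2 * gbar β N gf ℓ := Finset.sum_le_sum hterm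
    _ = 2 * Ct * R * gbar β N gf k ^ 2 * ∑ ℓ ∈ Ico k N, gbar β N gf ℓ := by rw [Finset.mul_sum]
    _ ≤ 2 * Ct * R * gbar β N gf k ^ 2 * (2 / Cm * |Real.log (gbar β N gf k)|) :=
        mul_le_mul_of_nonneg_left hsum (by positivity)
    _ = 4 * Ct / Cm * (gbar β N gf k ^ 2 * |Real.log (gbar β N gf k)|) * R := by ring

/-! ## Part 3. The `z` equation (ll. 3676–3700) -/

/-- `x³ = x^{(3:ℝ)}` and `x² = x^{(2:ℝ)}` bookkeeping for the sibling's rpow statements. [folklore] -/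
theorem rpow_three_eq (x : ℝ) : x ^ (3 : ℝ) = x ^ 3 := by
  exact_mod_cast Real.rpow_natCast x 3

/-- Summing the `z`-recursion: if `z_0 = 0` and `z_{k+1} = z_k + w_k`, then `z_k = Σ_{ℓ<k} w_ℓ`. [folklore] -/
theorem z_eq_sum {z w : ℕ → ℝ} (hz0 : z 0 = 0) (hz : ∀ k, k < N → z (k + 1) = z k + w k)
    {k : ℕ} (hk : k ≤ N) : z k = ∑ ℓ ∈ Ico 0 k, w ℓ := by
  induction k with
  | zero => simp [hz0]
  | succ k ih =>
    rw [hz k (Nat.lt_of_succ_le hk), ih (Nat.le_of_succ_le hk), Finset.sum_Ico_succ_top (Nat.zero_le k)]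

/-- **`|z_k| ≤ Z·ḡ_k²|log ḡ_k|·R`** for `k ≤ N`, `Z = (4/C₋)(2C_θG′ + 2C_θK′ + 1)`, for any solution of
`z_{k+1} = z_k + 2θ_kḡ_kg_k − θ^p_kḡ_kp_k − θ^v_kḡ_kv_k + r^z_k`, `z_0 = 0`, given `|θ_k|, |θ^p_k|, |θ^v_k| ≤ C_θ`,
a-priori `|g_k| ≤ G′ḡ_k²|log ḡ_k|R`, `|p_k|, |v_k| ≤ K′ḡ_k²R`, `|r^z_k| ≤ ḡ_k³R` — FOLLOWING THE PRINT:
*"`|z_k| ≤ CΣ_{ℓ=0}^{k−1}ḡ_ℓ³|log ḡ_ℓ|‖r‖_{X_r} ≤ Cḡ_k²|log ḡ_k|‖r‖_{X_r}`"* by (basicbound2) (`n = 3,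
m = 1`; the sibling's `zsum_bound`, `g_f ≤ 1/4`), the `ḡ_ℓ³`-terms absorbed by `|log ḡ_ℓ| ≥ 1`.
[cite: DimockYuan2024GNFlow, proof of Lemma 18 (arXiv:2303.07916v3 TeX ll. 3676–3700)] -/
theorem abs_z_le {Cm Cp R K' G' Cθ : ℝ} {z g p v rz θ θp θv : ℕ → ℝ} (hCm : 0 < Cm)
    (hβ : ∀ k, Cm ≤ β k ∧ β k ≤ Cp) (hgf : 0 < gf) (hgf4 : gf ≤ 1 / 4) (hsmall : Cp * gf ≤ 1)
    (hR : 0 ≤ R) (hK' : 0 ≤ K') (hG' : 0 ≤ G') (hθ : ∀ k, |θ k| ≤ Cθ)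
    (hθp : ∀ k, |θp k| ≤ Cθ) (hθv : ∀ k, |θv k| ≤ Cθ)
    (hgb : ∀ k, k ≤ N → |g k| ≤ G' * (gbar β N gf k ^ 2 * |Real.log (gbar β N gf k)|) * R)
    (hpb : ∀ k, k ≤ N → |p k| ≤ K' * gbar β N gf k ^ 2 * R)
    (hvb : ∀ k, k ≤ N → |v k| ≤ K' * gbar β N gf k ^ 2 * R)
    (hrz : ∀ k, |rz k| ≤ gbar β N gf k ^ 3 * R) (hz0 : z 0 = 0)
    (hz : ∀ k, k < N → z (k + 1) = z k + 2 * θ k * gbar β N gf k * g k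
        - θp k * gbar β N gf k * p k - θv k * gbar β N gf k * v k + rz k)
    {k : ℕ} (hk : k ≤ N) :
    |z k| ≤ 4 / Cm * (2 * Cθ * G' + 2 * Cθ * K' + 1) *
      (gbar β N gf k ^ 2 * |Real.log (gbar β N gf k)|) * R := by
  have hβpos : ∀ k, 0 < β k := fun k => lt_of_lt_of_le hCm (hβ k).1
  have hCθ : 0 ≤ Cθ := le_trans (abs_nonneg _) (hθ 0)
  set w : ℕ → ℝ := fun k => 2 * θ k * gbar β N gf k * g k
    - θp k * gbar β N gf k * p k - θv k * gbar β N gf k * v k + rz k with hwdef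
  have hz' : ∀ k, k < N → z (k + 1) = z k + w k := by intro k hk; rw [hz k hk, hwdef]; ring
  rw [z_eq_sum hz0 hz' hk]
  -- |log ḡ_ℓ| ≥ 1
  have hlog1 : ∀ ℓ, 1 ≤ |Real.log (gbar β N gf ℓ)| := by
    intro ℓ
    have hx := gbar_pos hβpos hgf (N := N) ℓ
    have hx4 : gbar β N gf ℓ ≤ 1 / 4 := (gbar_le_final hβpos hgf (N := N) ℓ).trans hgf4
    rw [abs_log_gbar hCm hβ hgf hgf4 ℓ]
    have h := two_mul_log_two_le_neg_log hx hx4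
    have : (1 : ℝ) ≤ 2 * Real.log 2 := by
      have := Real.log_two_gt_d9; linarith
    linarith
  set D : ℝ := 2 * Cθ * G' + 2 * Cθ * K' + 1 with hDdef
  have hterm : ∀ ℓ ∈ Ico 0 k,
      |w ℓ| ≤ D * R * (gbar β N gf ℓ ^ 3 * |Real.log (gbar β N gf ℓ)|) := by
    intro ℓ hℓ
    have hℓN : ℓ ≤ N := by have := (Finset.mem_Ico.mp hℓ).2; omega
    have hx := gbar_pos hβpos hgf (N := N) ℓ
    set x := gbar β N gf ℓ with hxdef
    set Lg := |Real.log x| with hLgdef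
    have hLg : 1 ≤ Lg := hlog1 ℓ
    have h1 : |2 * θ ℓ * x * g ℓ| ≤ 2 * Cθ * x * (G' * (x ^ 2 * Lg) * R) := by
      rw [abs_mul, abs_mul, abs_mul, abs_two, abs_of_pos hx]
      exact mul_le_mul (by nlinarith [hθ ℓ, abs_nonneg (θ ℓ)]) (hgb ℓ hℓN) (abs_nonneg _)
        (by positivity)
    have h2 : |θp ℓ * x * p ℓ| ≤ Cθ * x * (K' * x ^ 2 * R) := by
      rw [abs_mul, abs_mul, abs_of_pos hx]
      exact mul_le_mul (mul_le_mul_of_nonneg_right (hθp ℓ) hx.le) (hpb ℓ hℓN) (abs_nonneg _)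
        (by positivity)
    have h3 : |θv ℓ * x * v ℓ| ≤ Cθ * x * (K' * x ^ 2 * R) := by
      rw [abs_mul, abs_mul, abs_of_pos hx]
      exact mul_le_mul (mul_le_mul_of_nonneg_right (hθv ℓ) hx.le) (hvb ℓ hℓN) (abs_nonneg _)
        (by positivity)
    have h4 : |rz ℓ| ≤ x ^ 3 * R := hrz ℓ
    have hsplit : |w ℓ| ≤ |2 * θ ℓ * x * g ℓ| + |θp ℓ * x * p ℓ| + |θv ℓ * x * v ℓ| + |rz ℓ| := by
      have e : w ℓ = 2 * θ ℓ * x * g ℓ + (-(θp ℓ * x * p ℓ)) + (-(θv ℓ * x * v ℓ)) + rz ℓ := by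
        rw [hwdef]; ring
      rw [e]
      refine le_trans (abs_add_le _ _) ?_
      refine le_trans (add_le_add (abs_add_le _ _) le_rfl) ?_
      refine le_trans (add_le_add (add_le_add (abs_add_le _ _) le_rfl) le_rfl) ?_
      rw [abs_neg, abs_neg]
    -- absorb the x³ R terms using Lg ≥ 1
    have hx3 : 0 ≤ x ^ 3 * R := by positivity
    calc |w ℓ| ≤ |2 * θ ℓ * x * g ℓ| + |θp ℓ * x * p ℓ| + |θv ℓ * x * v ℓ| + |rz ℓ| := hsplit
      _ ≤ 2 * Cθ * x * (G' * (x ^ 2 * Lg) * R) + Cθ * x * (K' * x ^ 2 * R)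
          + Cθ * x * (K' * x ^ 2 * R) + x ^ 3 * R :=
          add_le_add (add_le_add (add_le_add h1 h2) h3) h4
      _ = 2 * Cθ * G' * R * (x ^ 3 * Lg) + (2 * Cθ * K' + 1) * (x ^ 3 * R) := by ring
      _ ≤ 2 * Cθ * G' * R * (x ^ 3 * Lg) + (2 * Cθ * K' + 1) * (x ^ 3 * R * Lg) := by
          have : x ^ 3 * R ≤ x ^ 3 * R * Lg := le_mul_of_one_le_right hx3 hLg
          have hc : 0 ≤ 2 * Cθ * K' + 1 := by positivity
          nlinarith [mul_le_mul_of_nonneg_left this hc]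
      _ = D * R * (x ^ 3 * Lg) := by rw [hDdef]; ring
  have hzs := zsum_bound (β := β) (N := N) hCm hβ hgf hsmall hgf4 hk
  simp only [rpow_three_eq, Real.rpow_two] at hzs
  have hD : 0 ≤ D := by rw [hDdef]; positivity
  calc |∑ ℓ ∈ Ico 0 k, w ℓ| ≤ ∑ ℓ ∈ Ico 0 k, |w ℓ| := Finset.abs_sum_le_sum_abs _ _
    _ ≤ ∑ ℓ ∈ Ico 0 k, D * R * (gbar β N gf ℓ ^ 3 * |Real.log (gbar β N gf ℓ)|) :=
        Finset.sum_le_sum hterm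
    _ = D * R * ∑ ℓ ∈ Ico 0 k, gbar β N gf ℓ ^ 3 * |Real.log (gbar β N gf ℓ)| := by
        rw [Finset.mul_sum]
    _ ≤ D * R * (4 / Cm * (gbar β N gf k ^ 2 * |Real.log (gbar β N gf k)|)) :=
        mul_le_mul_of_nonneg_left hzs (by positivity)
    _ = 4 / Cm * D * (gbar β N gf k ^ 2 * |Real.log (gbar β N gf k)|) * R := by ring

/-! ## Part 4. Existence, uniqueness, and the assembled Lemma 18 (scalar block) -/

/-- Existence of the `p/v` solution with zero initial condition (elementary recursion). [folklore] -/
theorem exists_pv (rp rv : ℕ → ℝ) :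
    ∃ p v : ℕ → ℝ, p 0 = 0 ∧ v 0 = 0 ∧
      (∀ k, p (k + 1) = p k - 2 * (βp k * gbar β N gf k) * v k + rp k) ∧
      (∀ k, v (k + 1) = -(βp k * gbar β N gf k) * p k + v k + rv k) := by
  let f : ℕ → ℝ × ℝ := fun n => Nat.rec ((0 : ℝ), (0 : ℝ))
    (fun k x => (x.1 - 2 * (βp k * gbar β N gf k) * x.2 + rp k,
      -(βp k * gbar β N gf k) * x.1 + x.2 + rv k)) n
  refine ⟨fun k => (f k).1, fun k => (f k).2, rfl, rfl, fun k => rfl, fun k => rfl⟩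

/-- Uniqueness of the `p/v` solution with zero initial condition (for `k ≤ N`). [folklore] -/
theorem pv_unique {p v p' v' rp rv : ℕ → ℝ} (hp0 : p 0 = 0) (hv0 : v 0 = 0)
    (hp0' : p' 0 = 0) (hv0' : v' 0 = 0)
    (hp : ∀ k, k < N → p (k + 1) = p k - 2 * (βp k * gbar β N gf k) * v k + rp k)
    (hv : ∀ k, k < N → v (k + 1) = -(βp k * gbar β N gf k) * p k + v k + rv k)
    (hp' : ∀ k, k < N → p' (k + 1) = p' k - 2 * (βp k * gbar β N gf k) * v' k + rp k)
    (hv' : ∀ k, k < N → v' (k + 1) = -(βp k * gbar β N gf k) * p' k + v' k + rv k)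
    {k : ℕ} (hk : k ≤ N) : p k = p' k ∧ v k = v' k := by
  induction k with
  | zero => exact ⟨by rw [hp0, hp0'], by rw [hv0, hv0']⟩
  | succ k ih =>
    have hkN : k < N := Nat.lt_of_succ_le hk
    obtain ⟨h1, h2⟩ := ih hkN.le
    exact ⟨by rw [hp k hkN, hp' k hkN, h1, h2], by rw [hv k hkN, hv' k hkN, h1, h2]⟩

/-- Existence of the `g` solution with final condition `g_N = 0` (counting down). [folklore] -/
theorem exists_g (hβ : ∀ k, 0 < β k) (hgf : 0 < gf) (t : ℕ → ℝ) :
    ∃ g : ℕ → ℝ, g N = 0 ∧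
      ∀ k, k < N → g (k + 1) = (1 + 2 * β k * gbar β N gf k) * g k + t k := by
  -- gRev m = g_{N - m}
  let gRev : ℕ → ℝ := fun n => Nat.rec (0 : ℝ)
    (fun m x => (1 + 2 * β (N - (m + 1)) * gbar β N gf (N - (m + 1)))⁻¹ * (x - t (N - (m + 1)))) n
  refine ⟨fun k => gRev (N - k), by simp [gRev], fun k hk => ?_⟩
  have hm : N - k = (N - (k + 1)) + 1 := by omega
  have hidx : N - (N - (k + 1) + 1) = k := by omega
  have hA : (1 + 2 * β k * gbar β N gf k) ≠ 0 := by
    have := mul_pos (hβ k) (gbar_pos hβ hgf (N := N) k); linarith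
  show gRev (N - (k + 1)) = (1 + 2 * β k * gbar β N gf k) * gRev (N - k) + t k
  rw [hm]
  simp only [gRev, hidx]
  field_simp
  ring

/-- Uniqueness of the `g` solution with final condition `g_N = 0` (for `k ≤ N`). [folklore] -/
theorem g_unique (hβ : ∀ k, 0 < β k) (hgf : 0 < gf) {g g' t : ℕ → ℝ} (hgN : g N = 0)
    (hgN' : g' N = 0)
    (hg : ∀ k, k < N → g (k + 1) = (1 + 2 * β k * gbar β N gf k) * g k + t k)
    (hg' : ∀ k, k < N → g' (k + 1) = (1 + 2 * β k * gbar β N gf k) * g' k + t k)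
    {k : ℕ} (hk : k ≤ N) : g k = g' k := by
  rw [g_eq_backward_sum hβ hgf hgN hg hk, g_eq_backward_sum hβ hgf hgN' hg' hk]

/-- Existence of the `z` solution with zero initial condition. [folklore] -/
theorem exists_z (w : ℕ → ℝ) : ∃ z : ℕ → ℝ, z 0 = 0 ∧ ∀ k, z (k + 1) = z k + w k :=
  ⟨fun k => ∑ ℓ ∈ Ico 0 k, w ℓ, by simp, fun k => by
    show ∑ ℓ ∈ Ico 0 (k + 1), w ℓ = (∑ ℓ ∈ Ico 0 k, w ℓ) + w k
    rw [Finset.sum_Ico_succ_top (Nat.zero_le k)]⟩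

/-- Uniqueness of the `z` solution with zero initial condition (for `k ≤ N`). [folklore] -/
theorem z_unique {z z' w : ℕ → ℝ} (hz0 : z 0 = 0) (hz0' : z' 0 = 0)
    (hz : ∀ k, k < N → z (k + 1) = z k + w k) (hz' : ∀ k, k < N → z' (k + 1) = z' k + w k)
    {k : ℕ} (hk : k ≤ N) : z k = z' k := by
  rw [z_eq_sum hz0 hz hk, z_eq_sum hz0' hz' hk]

/-- **Dimock–Yuan 2024, Lemma 18 — the scalar block, PROVED with explicit constants.**  Along the
backward quadratic flow `ḡ` (`0 < C₋ ≤ β_k ≤ C₊`, `0 ≤ β′_k ≤ β_k`, `|θ_k|, |θ^p_k|, |θ^v_k| ≤ C_θ`),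
with `g_f ≤ 1/4`, `C₊g_f ≤ 1`, `2C₊g_f ≤ log(3/2)`, `4C₊g_f ≤ log 2` (the explicit form of the paper's standing
smallness of `g_f`, Lemmas 17/19: *"For `g_f` sufficiently small"*, ll. 3329/3706), let
`(g, z, p, v)` solve the `(g,z,p,v)`-rows of `y_{k+1} = L_k y_k + r_k` (matrix (amos2)) with the null
boundary conditions `g_N = 0`, `z_0 = p_0 = v_0 = 0`, and let `|r^•_k| ≤ ḡ_k³·R`.  Then for all `k ≤ N`:
`|p_k| ≤ Kḡ_k²R`, `|v_k| ≤ Kḡ_k²R`, `|g_k| ≤ Gḡ_k²|log ḡ_k|R`, `|z_k| ≤ Zḡ_k²|log ḡ_k|R` with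
`K = (1+√2)/((2−√2)C₋)`, `G = 4(6C₊K + 1)/C₋`, `Z = (4/C₋)(2C_θG + 2C_θK + 1)` — i.e. the scalar
components of *"`‖y‖_{X_w} ≤ C‖r‖_{X_r}`"* with `C = max(K, G, Z)`.
[cite: DimockYuan2024GNFlow, Lemma 18 (\label{pixie}) and its proof (arXiv:2303.07916v3 TeX ll. 3545–3700)] -/
theorem DimockYuan2024_lemma18_scalar {Cm Cp Cθ R : ℝ}
    {g z p v rg rz rp rv θ θp θv : ℕ → ℝ} (hCm : 0 < Cm)
    (hβ : ∀ k, Cm ≤ β k ∧ β k ≤ Cp) (hβp : ∀ k, 0 ≤ βp k ∧ βp k ≤ β k) (hgf : 0 < gf)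
    (hgf4 : gf ≤ 1 / 4) (hsmall : Cp * gf ≤ 1)
    (hγ1 : 2 * (Cp * gf) ≤ Real.log (3 / 2)) (hγ2 : 4 * (Cp * gf) ≤ Real.log 2) (hR : 0 ≤ R)
    (hθ : ∀ k, |θ k| ≤ Cθ) (hθp : ∀ k, |θp k| ≤ Cθ) (hθv : ∀ k, |θv k| ≤ Cθ)
    (hrg : ∀ k, |rg k| ≤ gbar β N gf k ^ 3 * R) (hrz : ∀ k, |rz k| ≤ gbar β N gf k ^ 3 * R)
    (hrp : ∀ k, |rp k| ≤ gbar β N gf k ^ 3 * R) (hrv : ∀ k, |rv k| ≤ gbar β N gf k ^ 3 * R)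
    (hp0 : p 0 = 0) (hv0 : v 0 = 0) (hz0 : z 0 = 0) (hgN : g N = 0)
    (hp : ∀ k, k < N → p (k + 1) = p k - 2 * (βp k * gbar β N gf k) * v k + rp k)
    (hv : ∀ k, k < N → v (k + 1) = -(βp k * gbar β N gf k) * p k + v k + rv k)
    (hg : ∀ k, k < N → g (k + 1) = (1 + 2 * β k * gbar β N gf k) * g k
        - 2 * (βp k * gbar β N gf k) * p k - 4 * (βp k * gbar β N gf k) * v k + rg k)
    (hz : ∀ k, k < N → z (k + 1) = z k + 2 * θ k * gbar β N gf k * g k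
        - θp k * gbar β N gf k * p k - θv k * gbar β N gf k * v k + rz k)
    {k : ℕ} (hk : k ≤ N) :
    let K := (1 + Real.sqrt 2) / ((2 - Real.sqrt 2) * Cm)
    let G := 4 * (6 * Cp * K + 1) / Cm
    let Z := 4 / Cm * (2 * Cθ * G + 2 * Cθ * K + 1)
    |p k| ≤ K * gbar β N gf k ^ 2 * R ∧ |v k| ≤ K * gbar β N gf k ^ 2 * R ∧
      |g k| ≤ G * (gbar β N gf k ^ 2 * |Real.log (gbar β N gf k)|) * R ∧
      |z k| ≤ Z * (gbar β N gf k ^ 2 * |Real.log (gbar β N gf k)|) * R := by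
  intro K G Z
  have hs2 : Real.sqrt 2 < 2 := by
    rw [show (2 : ℝ) = Real.sqrt 4 by
      rw [show (4 : ℝ) = 2 ^ 2 by norm_num, Real.sqrt_sq (by norm_num)]]
    exact Real.sqrt_lt_sqrt (by norm_num) (by norm_num)
  have hs0 : 0 ≤ Real.sqrt 2 := Real.sqrt_nonneg 2
  have hCp : 0 ≤ Cp := le_trans hCm.le ((hβ 0).1.trans (hβ 0).2)
  have hK : 0 ≤ K := div_nonneg (by linarith) (mul_pos (by linarith) hCm).le
  have hG : 0 ≤ G := by positivity
  have hpb : ∀ k, k ≤ N → |p k| ≤ K * gbar β N gf k ^ 2 * R :=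
    fun k hk => abs_p_le hCm hβ hβp hgf hsmall hR hp0 hv0 hp hv hrp hrv hk
  have hvb : ∀ k, k ≤ N → |v k| ≤ K * gbar β N gf k ^ 2 * R :=
    fun k hk => abs_v_le hCm hβ hβp hgf hsmall hR hp0 hv0 hp hv hrp hrv hk
  have hgb : ∀ k, k ≤ N → |g k| ≤ G * (gbar β N gf k ^ 2 * |Real.log (gbar β N gf k)|) * R :=
    fun k hk => abs_g_le hCm hβ hβp hgf hgf4 hsmall hγ1 hγ2 hR hK hpb hvb hrg hgN hg hk
  exact ⟨hpb k hk, hvb k hk, hgb k hk,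
    abs_z_le hCm hβ hgf hgf4 hsmall hR hK hG hθ hθp hθv hgb hpb hvb hrz hz0 hz hk⟩

end Literature.MathematicalPhysics.QuantumFieldTheory.DimockYuan2024.FirstLinearEquation

end
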